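import Summits.Ventures.PercRepro.ProfileGapMonoThresholdCorankTwo

/-!
# PercRepro — THE CLASS BOUND: a dual-rank-`2` complement has at least `C(#O − 1, 2)` transversal triples (p5,
gen 31; `proofs/P5-GM1.md` §43(f)(1))

On a coloop-free matroid a set all of whose pairs are series has dual rank `1` (`rk_sdiff_add_card_of_all_series`:
`ρ(E ∖ X) + #X = ρ(E) + 1`), so the complement `O = E ∖ cl B` of a rank-`(q−1)` flat with `ν + q − 3` points
(dual rank `2`, CorankTwo) contains a non-series pair (`exists_not_series_pair`).  Taking the series class `C₀` of
one point `x₀` inside `O`, every triple of `O` meeting both `C₀` and `O ∖ C₀` contains a non-series pair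
(transitivity, `rk_sdiff_pair_trans`) and is therefore a cocircuit-carrying triple `ρ(E ∖ Y) + 1 = ρ(E)`
(`rk_sdiff_add_one_of_triple_not_series`); there are `C(s, 3) − C(c, 3) − C(s − c, 3) ≥ C(s − 1, 2)` of them
(`choose_three_split`), `s = #O`, `c = #C₀`: **`card_transversal_triples_ge`**.  Nothing open is asserted.
-/

open scoped Matroid

namespace PercRepro.Cogirth

open Finset ThmH Skew Shadow Profile

variable {α : Type} [DecidableEq α] {N : Matroid α} [N.Finite] {q : ℕ}

section Arith

/-- `C(a, 3) + C(b, 3) ≤ C(a + b − 1, 3)` for `1 ≤ a, b`. -/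
theorem choose_three_add_le (a : ℕ) (ha : 1 ≤ a) : ∀ b, 1 ≤ b → a.choose 3 + b.choose 3 ≤ (a + b - 1).choose 3 := by
  intro b hb
  induction b with
  | zero => omega
  | succ b ih =>
    rcases Nat.eq_zero_or_pos b with rfl | hbpos
    · rw [zero_add, Nat.choose_eq_zero_of_lt (by norm_num : 1 < 3), add_zero, show a + 1 - 1 = a by omega]
    · have h1 := ih hbpos
      have h2 : (b + 1).choose 3 = b.choose 3 + b.choose 2 := by
        rw [Nat.choose_succ_succ, add_comm]
      have h3 : (a + (b + 1) - 1).choose 3 = (a + b - 1).choose 3 + (a + b - 1).choose 2 := by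
        rw [show a + (b + 1) - 1 = (a + b - 1) + 1 by omega, Nat.choose_succ_succ, add_comm]
      have h4 : b.choose 2 ≤ (a + b - 1).choose 2 := Nat.choose_le_choose 2 (by omega)
      omega

/-- `C(c, 3) + C(s − c, 3) + C(s − 1, 2) ≤ C(s, 3)` for `1 ≤ c ≤ s − 1`. -/
theorem choose_three_split (s c : ℕ) (hc : 1 ≤ c) (hcs : c + 1 ≤ s) :
    c.choose 3 + (s - c).choose 3 + (s - 1).choose 2 ≤ s.choose 3 := by
  have h1 := choose_three_add_le c hc (s - c) (by omega)
  rw [show c + (s - c) - 1 = s - 1 by omega] at h1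
  have h2 : s.choose 3 = (s - 1).choose 3 + (s - 1).choose 2 := by
    obtain ⟨s', rfl⟩ : ∃ s', s = s' + 1 := ⟨s - 1, by omega⟩
    rw [Nat.choose_succ_succ, add_comm, Nat.add_sub_cancel]
  omega

end Arith

section AllSeries

/-- **A set all of whose pairs are series has dual rank `1`** on a coloop-free matroid: for a non-empty `X ⊆ E`
with `ρ(E ∖ {x, y}) + 1 = ρ(E)` for all distinct `x, y ∈ X`, `ρ(E ∖ X) + #X = ρ(E) + 1`. -/
theorem rk_sdiff_add_card_of_all_series (hcf : ∀ z ∈ gr N, rk N ((gr N).erase z) = rk N (gr N)) (X : Finset α) :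
    X ⊆ gr N → X.Nonempty → (∀ x ∈ X, ∀ y ∈ X, x ≠ y → rk N (gr N \ {x, y}) + 1 = rk N (gr N)) →
      rk N (gr N \ X) + X.card = rk N (gr N) + 1 := by
  induction X using Finset.induction_on with
  | empty => intro _ h; exact absurd h not_nonempty_empty
  | insert x X hxX ih =>
    intro hX _ hser
    rcases X.eq_empty_or_nonempty with rfl | hne
    · rw [insert_empty, card_singleton, sdiff_singleton_eq_erase, hcf x (hX (mem_singleton_self x))]
    · have hX' : X ⊆ gr N := (subset_insert x X).trans hX
      have hser' : ∀ a ∈ X, ∀ b ∈ X, a ≠ b → rk N (gr N \ {a, b}) + 1 = rk N (gr N) := fun a ha b hb hab =>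
        hser a (mem_insert_of_mem ha) b (mem_insert_of_mem hb) hab
      have hrec := ih hX' hne hser'
      obtain ⟨x₁, hx₁⟩ := hne
      have hxx₁ : x ≠ x₁ := fun h => hxX (h ▸ hx₁)
      have hpair := hser x (mem_insert_self x X) x₁ (mem_insert_of_mem hx₁) hxx₁
      -- submodularity on `E ∖ X` and `E ∖ {x, x₁}`
      have hU : gr N \ X ∪ gr N \ {x, x₁} = (gr N).erase x₁ := by
        ext w
        simp only [mem_union, mem_sdiff, mem_insert, mem_singleton, mem_erase, not_or]
        constructor
        · rintro (⟨hw, hwX⟩ | ⟨hw, _, hwx₁⟩)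
          · exact ⟨fun h => hwX (h ▸ hx₁), hw⟩
          · exact ⟨hwx₁, hw⟩
        · rintro ⟨hwx₁, hw⟩
          by_cases hwX : w ∈ X
          · exact Or.inr ⟨hw, fun h => hxX (h ▸ hwX), hwx₁⟩
          · exact Or.inl ⟨hw, hwX⟩
      have hI : gr N \ X ∩ (gr N \ {x, x₁}) = gr N \ insert x X := by
        ext w
        simp only [mem_inter, mem_sdiff, mem_insert, mem_singleton, not_or]
        constructor
        · rintro ⟨⟨hw, hwX⟩, _, hwx, _⟩
          exact ⟨hw, hwx, hwX⟩
        · rintro ⟨hw, hwx, hwX⟩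
          exact ⟨⟨hw, hwX⟩, hw, hwx, fun h => hwX (h ▸ hx₁)⟩
      have hsub := rk_union_add_rk_inter_le (M := N) (gr N \ X) (gr N \ {x, x₁})
      rw [hU, hI, hcf x₁ (hX (mem_insert_of_mem hx₁))] at hsub
      have hlow := rk_union_le_rk_add_card (N := N) (gr N \ insert x X) {x}
      have hcover : gr N \ insert x X ∪ {x} = gr N \ X := by
        ext w
        simp only [mem_union, mem_sdiff, mem_insert, mem_singleton, not_or]
        constructor
        · rintro (⟨hw, _, hwX⟩ | hwx)
          · exact ⟨hw, hwX⟩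
          · rw [hwx]
            exact ⟨hX (mem_insert_self x X), hxX⟩
        · rintro ⟨hw, hwX⟩
          by_cases hwx : w = x
          · exact Or.inr hwx
          · exact Or.inl ⟨hw, hwx, hwX⟩
      rw [hcover, card_singleton] at hlow
      rw [card_insert_of_notMem hxX]
      omega

end AllSeries

section ClassBound

variable (hcf : ∀ z ∈ gr N, rk N ((gr N).erase z) = rk N (gr N)) {B : Finset α} (hB : B ∈ Rq N (q - 1))
  (hF : (clF N B).card + rk N (gr N) = (gr N).card + (q - 3))

include hcf hB hF in
/-- **The complement of the flat contains a non-series pair** (`3 ≤ q`, the flat of rank `q − 1 < ρ(E) − 1`, i.e.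
`q + 1 ≤ ρ(E)`... in the form `q ≤ ρ(E)` with `2 ≤ #O`): otherwise its dual rank would be `1`. -/
theorem exists_not_series_pair (hq : 3 ≤ q) (hR : q ≤ rk N (gr N)) :
    ∃ x ∈ gr N \ clF N B, ∃ y ∈ gr N \ clF N B, x ≠ y ∧ rk N (gr N \ {x, y}) = rk N (gr N) := by
  by_contra hall
  simp only [not_exists, not_and] at hall
  have hcl : clF N B ⊆ gr N := clF_subset_gr B
  have hO : (gr N \ clF N B).card + (clF N B).card = (gr N).card := card_sdiff_add_card_eq_card hcl
  have hrkF : rk N (clF N B) = q - 1 := rk_clF_of_mem_Rq hB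
  have hne : (gr N \ clF N B).Nonempty := by
    rw [← card_pos]
    omega
  have hser : ∀ x ∈ gr N \ clF N B, ∀ y ∈ gr N \ clF N B, x ≠ y →
      rk N (gr N \ {x, y}) + 1 = rk N (gr N) := by
    intro x hx y hy hxy
    have h1 : rk N (gr N \ {x, y}) ≠ rk N (gr N) := hall x hx y hy hxy
    -- pairs have co-rank ρ(E) − 1 or ρ(E)
    have h2 : gr N \ {x, y} = ((gr N).erase x).erase y := by
      ext w
      simp only [mem_sdiff, mem_insert, mem_singleton, mem_erase, not_or]
      tauto
    have h3 := rk_le_rk_erase_succ (N := N) (erase_subset x (gr N)) y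
    have h4 := rk_mono' (M := N) (sdiff_subset : gr N \ {x, y} ⊆ gr N)
    rw [hcf x (mem_sdiff.1 hx).1] at h3
    rw [h2] at h1 h4 ⊢
    omega
  have h := rk_sdiff_add_card_of_all_series hcf (gr N \ clF N B) sdiff_subset hne hser
  rw [Finset.sdiff_sdiff_eq_self hcl, hrkF] at h
  omega

include hB hF in
/-- **A triple of the complement containing a non-series pair is a cocircuit-carrying triple** (`3 ≤ q`):
`Y ⊆ E ∖ cl B`, `#Y = 3`, with `y ≠ z ∈ Y` and `ρ(E ∖ {y, z}) = ρ(E)` give `ρ(E ∖ Y) + 1 = ρ(E)`. -/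
theorem rk_sdiff_add_one_of_triple_not_series (hq : 3 ≤ q) {Y : Finset α} (hY : Y ⊆ gr N \ clF N B)
    (hYc : Y.card = 3) {y z : α} (hy : y ∈ Y) (hz : z ∈ Y) (hyz : y ≠ z)
    (hpair : rk N (gr N \ {y, z}) = rk N (gr N)) : rk N (gr N \ Y) + 1 = rk N (gr N) := by
  have hle := rk_sdiff_add_card_le_of_subset_compl hB hF hq hY
  rw [hYc] at hle
  have hsub : gr N \ {y, z} ⊆ gr N \ Y ∪ (Y \ {y, z}) := by
    intro w hw
    obtain ⟨hwg, hwyz⟩ := mem_sdiff.1 hw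
    by_cases hwY : w ∈ Y
    · exact mem_union_right _ (mem_sdiff.2 ⟨hwY, hwyz⟩)
    · exact mem_union_left _ (mem_sdiff.2 ⟨hwg, hwY⟩)
  have h1 := rk_mono' (M := N) hsub
  have h2 := rk_union_le_rk_add_card (N := N) (gr N \ Y) (Y \ {y, z})
  have hyzY : ({y, z} : Finset α) ⊆ Y := by
    intro w hw
    simp only [mem_insert, mem_singleton] at hw
    rcases hw with rfl | rfl <;> assumption
  have h3 : (Y \ {y, z}).card + ({y, z} : Finset α).card = Y.card := card_sdiff_add_card_eq_card hyzY
  have h4 : ({y, z} : Finset α).card = 2 := by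
    rw [card_insert_of_notMem (by simpa using hyz), card_singleton]
  omega

include hcf hB hF in
/-- **THE CLASS BOUND** (`3 ≤ q ≤ ρ(E)`): the complement `O = E ∖ cl B` has at least `C(#O − 1, 2)` triples of
co-rank `ρ(E) − 1` — the triples meeting both the series class `C₀` of a point `x₀` and `O ∖ C₀`. -/
theorem card_transversal_triples_ge (hq : 3 ≤ q) (hR : q ≤ rk N (gr N)) :
    ((gr N \ clF N B).card - 1).choose 2 ≤
      (((gr N \ clF N B).powersetCard 3).filter (fun Y => rk N (gr N \ Y) + 1 = rk N (gr N))).card := by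
  obtain ⟨x₀, hx₀, z₀, hz₀, hxz, hpair⟩ := exists_not_series_pair hcf hB hF hq hR
  set O := gr N \ clF N B with hOdef
  set C₀ := O.filter (fun y => y = x₀ ∨ rk N (gr N \ {x₀, y}) + 1 = rk N (gr N)) with hC₀def
  have hC₀O : C₀ ⊆ O := filter_subset _ _
  have hx₀C : x₀ ∈ C₀ := mem_filter.2 ⟨hx₀, Or.inl rfl⟩
  have hz₀C : z₀ ∉ C₀ := by
    intro h
    rcases (mem_filter.1 h).2 with h | h
    · exact hxz h.symm
    · omega
  -- a point of `C₀` and a point of `O ∖ C₀` are never in series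
  have hcross : ∀ y ∈ C₀, ∀ z ∈ O, z ∉ C₀ → rk N (gr N \ {y, z}) = rk N (gr N) := by
    intro y hy z hz hzC
    have hzx₀ : z ≠ x₀ := fun h => hzC (h ▸ hx₀C)
    have hzser : ¬ (rk N (gr N \ {x₀, z}) + 1 = rk N (gr N)) := fun h => hzC (mem_filter.2 ⟨hz, Or.inr h⟩)
    -- pairs have co-rank `ρ(E) − 1` or `ρ(E)`
    have hpairs : ∀ a ∈ gr N, ∀ b ∈ gr N, a ≠ b →
        rk N (gr N \ {a, b}) + 1 = rk N (gr N) ∨ rk N (gr N \ {a, b}) = rk N (gr N) := by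
      intro a ha b hb hab
      have h2 : gr N \ {a, b} = ((gr N).erase a).erase b := by
        ext w
        simp only [mem_sdiff, mem_insert, mem_singleton, mem_erase, not_or]
        tauto
      have h3 := rk_le_rk_erase_succ (N := N) (erase_subset a (gr N)) b
      have h4 := rk_mono' (M := N) (sdiff_subset : gr N \ {a, b} ⊆ gr N)
      rw [hcf a ha] at h3
      rw [h2] at h4 ⊢
      omega
    rcases (mem_filter.1 hy).2 with rfl | hyser
    · rcases hpairs y (mem_sdiff.1 hx₀).1 z (mem_sdiff.1 hz).1 (Ne.symm hzx₀) with h | h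
      · exact absurd h hzser
      · exact h
    · have hyx₀ : y ≠ x₀ := fun h => by
        rw [h] at hyser
        -- `{x₀, x₀}` is a singleton: its co-rank is `ρ(E)`
        have : gr N \ ({x₀, x₀} : Finset α) = (gr N).erase x₀ := by
          ext w
          simp only [mem_sdiff, mem_insert, mem_singleton, or_self, mem_erase]
          tauto
        rw [this, hcf x₀ (mem_sdiff.1 hx₀).1] at hyser
        omega
      have hyz : y ≠ z := fun h => hzC (h ▸ hy)
      rcases hpairs y (mem_sdiff.1 (hC₀O hy)).1 z (mem_sdiff.1 hz).1 hyz with h | h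
      · -- `y ~ z` and `y ~ x₀` would give `x₀ ~ z`
        exfalso
        apply hzser
        have hyx₀' : rk N (gr N \ {y, x₀}) + 1 = rk N (gr N) := by
          rw [pair_comm]; exact hyser
        exact rk_sdiff_pair_trans hcf (mem_sdiff.1 hx₀).1 (mem_sdiff.1 (hC₀O hy)).1 hzx₀.symm
          (by rw [pair_comm]; exact hyx₀') h
      · exact h
  -- the mixed triples are transversal
  have hmixed : ∀ Y ∈ O.powersetCard 3, (Y ∩ C₀).Nonempty → (Y \ C₀).Nonempty →
      rk N (gr N \ Y) + 1 = rk N (gr N) := by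
    intro Y hY hYC hYD
    obtain ⟨hYO, hYc⟩ := mem_powersetCard.1 hY
    obtain ⟨y, hy⟩ := hYC
    obtain ⟨z, hz⟩ := hYD
    obtain ⟨hyY, hyC⟩ := mem_inter.1 hy
    obtain ⟨hzY, hzC⟩ := mem_sdiff.1 hz
    have hyz : y ≠ z := fun h => hzC (h ▸ hyC)
    exact rk_sdiff_add_one_of_triple_not_series hB hF hq hYO hYc hyY hzY hyz
      (hcross y hyC z (hYO hzY) hzC)
  -- counting: the triples inside `C₀`, inside `O ∖ C₀`, and the mixed ones
  set mixed := (O.powersetCard 3).filter (fun Y => (Y ∩ C₀).Nonempty ∧ (Y \ C₀).Nonempty) with hmdef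
  have hcover : O.powersetCard 3 ⊆ mixed ∪ C₀.powersetCard 3 ∪ (O \ C₀).powersetCard 3 := by
    intro Y hY
    obtain ⟨hYO, hYc⟩ := mem_powersetCard.1 hY
    by_cases h1 : (Y ∩ C₀).Nonempty
    · by_cases h2 : (Y \ C₀).Nonempty
      · exact mem_union_left _ (mem_union_left _ (mem_filter.2 ⟨hY, h1, h2⟩))
      · rw [not_nonempty_iff_eq_empty, sdiff_eq_empty_iff_subset] at h2
        exact mem_union_left _ (mem_union_right _ (mem_powersetCard.2 ⟨h2, hYc⟩))
    · rw [not_nonempty_iff_eq_empty] at h1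
      refine mem_union_right _ (mem_powersetCard.2 ⟨subset_sdiff.2 ⟨hYO, disjoint_iff_inter_eq_empty.2 h1⟩, hYc⟩)
  have hmixed_good : mixed ⊆ (O.powersetCard 3).filter (fun Y => rk N (gr N \ Y) + 1 = rk N (gr N)) := by
    intro Y hY
    obtain ⟨hYp, h1, h2⟩ := mem_filter.1 hY
    exact mem_filter.2 ⟨hYp, hmixed Y hYp h1 h2⟩
  have hcount := (card_le_card hcover).trans ((card_union_le _ _).trans
    (Nat.add_le_add_right (card_union_le _ _) _))
  rw [card_powersetCard, card_powersetCard, card_powersetCard] at hcount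
  have hc1 : 1 ≤ C₀.card := card_pos.2 ⟨x₀, hx₀C⟩
  have hcs : C₀.card + 1 ≤ O.card := by
    have := card_lt_card (Finset.ssubset_iff_of_subset hC₀O |>.2 ⟨z₀, hz₀, hz₀C⟩)
    omega
  have hOC : (O \ C₀).card = O.card - C₀.card := card_sdiff_of_subset hC₀O
  rw [hOC] at hcount
  have harith := choose_three_split O.card C₀.card hc1 hcs
  have hle := card_le_card hmixed_good
  omega

end ClassBound

end PercRepro.Cogirth
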